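import Mathlib
import Summits.ValiantsHypothesis.ValiantsHypothesis.Theorems.LacunarySymmetroidMatrixDescartesCensusDefs
import Summits.ValiantsHypothesis.ValiantsHypothesis.Theorems.LacunarySymmetroidMatrixDescartesCensusFormatMonotone

/-!
# Tower graft line, stub S4g: size monotonicity of the class budget

By-name closer for the registered stub **S4g `stub_sizeMono : PosRootLawSizeMono`** of the line
`Cruxes/WeakLifting/Lines/tower_graft.lean` (rev 8 @78ef05dfcd86; crux `WeakLifting` = stmt-ValiantsHypothesis-19561, restricted
sub-case `TowerWeakLifting`; line planner val-idea-24 g0, critic of record val-idea-crit-6 g0 (#7h/#7i), desk R2724/R2729).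

`sizeMono` is the line's `PosRootLawSizeMono` VERBATIM (the line def inlined; the tree's `PosRootLawOn` imported), so the line
discharges the stub by `exact`.  Content (size monotonicity of the SUPPORT-LEVEL positive-root budget): a bound `B` valid for all
real symmetric size-`m'` pencils on the support `d` is valid for all size-`m ≤ m'` ones.  It is the support-level reading of the
tree's format-level `Census.posRootLawAt_of_le_size` and uses the same pencil-level identity padding `Census.exists_pad`
(letters `S l ⊕ 1`, determinant `det G * (∑ l, X ^ d l) ^ r`, so the positive roots of `det G` are among those of the big pencil);
the empty format `K = 0` has no roots at all (handled inline), so the support-level statement needs no `K ≥ 1`.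

Def-free.  HONEST FRAMING: an M-sized bookkeeping joint of the SIZE-INDUCTION spine (rev 8: S4f + S4g + S4h ⇒ TowerB) of a
skeleton for a RESTRICTED sub-case; it proves nothing about `WeakLifting`, Conjecture B / `KPlusLogSqLaw`, `MatrixDescartes`
(18050) or `VP ≠ VNP`.  Seat: prover val-sym-lift-p3 g17, `--supports stmt-ValiantsHypothesis-19561`.
-/

-- `Summit.ValiantsHypothesis.ValiantsHypothesis.…` repeats a component by the D-0017 layout
-- (single-conjunct summit), which the `dupNamespace` linter flags; the name is mandated.
set_option linter.dupNamespace false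

namespace Summit.ValiantsHypothesis.ValiantsHypothesis.Theorems.KPlusLogSqLaw.TowerGraft

open Finset Polynomial Matrix
open scoped BigOperators Polynomial
open Summit.ValiantsHypothesis.ValiantsHypothesis.Theorems.LacunarySymmetroidMatrixDescartes (PosRootLawOn)

/-- **S4g `stub_sizeMono` (the line's `PosRootLawSizeMono`, verbatim).**  A positive-root bound for all size-`m'` real
symmetric pencils on the support `d` bounds the size-`m ≤ m'` ones: block-diagonal embedding `S l ↦ S l ⊕ 1` (`Census.exists_pad`),
whose pencil determinant is `det G * (∑ l, X ^ d l) ^ (m' - m)`, so the positive roots of `det G` are among those of the big pencil.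
[this work] -/
theorem sizeMono :
    ∀ (m m' K B : ℕ) (d : Fin K → ℕ), m ≤ m' → PosRootLawOn m' K B d → PosRootLawOn m K B d := by
  intro m m' K B d hmm' hlaw
  obtain ⟨r, rfl⟩ := Nat.exists_eq_add_of_le hmm'
  intro S hS
  rcases Nat.eq_zero_or_pos K with hK | hK
  · -- the empty format (`K = 0`): the pencil is `0` (or the empty matrix) and has no roots
    subst hK
    have h0 : (∑ l : Fin 0, (Polynomial.X : Polynomial ℝ) ^ d l • (S l).map Polynomial.C) = 0 := by simp
    rw [h0]
    rcases Nat.eq_zero_or_pos m with hm | hm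
    · subst hm
      simp [Matrix.det_isEmpty]
    · haveI : Nonempty (Fin m) := ⟨⟨0, hm⟩⟩
      simp [Matrix.det_zero]
  obtain ⟨S', hS', -, hle⟩ :=
    Summit.ValiantsHypothesis.ValiantsHypothesis.Theorems.LacunarySymmetroidMatrixDescartes.Census.exists_pad (n := r) hK d S hS
  exact hle.trans (hlaw S' hS')

end Summit.ValiantsHypothesis.ValiantsHypothesis.Theorems.KPlusLogSqLaw.TowerGraft
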